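import Summits.AtomisticToContinuum.FouriersLaw.Theses.PhononMeanFreePath
import Summits.AtomisticToContinuum.FouriersLaw.Theorems.BoundaryKubo.Negative.LoadBearing
import Literature.MathematicalPhysics.KineticTheory.LangevinChainReach
import Literature.Probability.Process.SmallSets
import Mathlib.MeasureTheory.Measure.Portmanteau

/-!
# Uniform minorisation of the driven kernels near an equilibrium temperature pair
(stub `stub_uniformMinorization_of` of line `gibbs-ttcf`, crux stmt-AtomisticToContinuum-11812
`PhononMeanFreePath.BoundaryKubo`)

For `P = pinnedChain ω₂ lam β γ` (all `> 0`), `N+1` sites and `T > 0`, write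
`K^δ_t = P.transitionKernel (N+1) (T+δ/2) (T-δ/2) t`. From three inputs stated as hypotheses —
(1) a local minorisation at time one near the equilibrium `0` with constants uniform for bath
temperatures in a compact range, (2) short-time confinement near `0` uniform for bounded
temperatures, (3) the Feller property jointly in (temperatures, initial condition) — we prove
CEHR Prop. 3.6 for the whole family `|δ| ≤ T` with a minorisation MASS uniform in `δ`: for every
compact `C` there is `t_C` such that for all `t ≥ t_C` some `α > 0` and a probability measure `ν`
satisfy `α ν ≤ K^δ_t(z, ·)` for all `z ∈ C` and all `|δ| ≤ T`.

The proof is the pointed small-set theorem of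
`Literature.Probability.Process.MarkovSemigroup.exists_smul_le_of_isCompact_of_mem` re-run for the
family: the local small set `G₀ = B(0, ε₁/2)`, `ν₀ = (c/2)·Leb|_{B(0,r)}`, window `[1, 1+η']`
(Chapman–Kolmogorov of (1) with (2)) has its base point `0` INSIDE `G₀`, so the return bound on the
window is `ν₀(G₀)` itself, uniformly in `δ`; windows are iterated (`pow_le_apply_of_window`,
`exists_nat_mul_le_le_mul`); and the compact set `[-T, T] × C` of (parameter, initial condition)
is covered by finitely many opens on which `K^δ_{s_i}(·, G₀) ≥ a_i > 0` (pointwise reachability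
`pinnedChain_exists_transitionKernel_pos_of_zero_mem` + lower semicontinuity from (3) by the
portmanteau theorem).
-/

noncomputable section

open scoped NNReal ENNReal Topology
open MeasureTheory Filter Set

namespace Summit.AtomisticToContinuum.FouriersLaw.Theorems.BoundaryKubo.GibbsTtcf

open Literature.MathematicalPhysics.KineticTheory.HeatConduction
open Literature.Probability.Process ProbabilityTheory
open Summit.AtomisticToContinuum.FouriersLaw.Theorems.BoundaryKubo.Negative.LoadBearing
  (kuboIntegrand kuboValue LimitClause UniqueSteady SteadyFamily boundaryKubo_iff)

/-- **Uniform minorisation from the three uniform inputs** (CEHR 2018 Prop. 3.6 for the family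
`K^δ`, `|δ| ≤ T`, with a minorisation mass uniform in `δ`). [cite: CuneoEckmannHairerReyBellet2018, Prop 3.6] -/
theorem stub_uniformMinorization_of :
    (∀ ω₂ lam β γ : ℝ, 0 < ω₂ → 0 < lam → 0 < β → 0 < γ → ∀ (N : ℕ) (Tlo Thi : ℝ), 0 < Tlo → Tlo ≤ Thi →
      ∃ ε₁ : ℝ, 0 < ε₁ ∧ ∃ r : ℝ, 0 < r ∧ ∃ c : ℝ≥0∞, 0 < c ∧
        ∀ a b : ℝ, Tlo ≤ a → a ≤ Thi → Tlo ≤ b → b ≤ Thi →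
          ∀ z : PhaseSpace (N + 1), ‖z‖ < ε₁ →
            ∀ S ⊆ Metric.ball (0 : PhaseSpace (N + 1)) r, MeasurableSet S →
              c * volume S ≤ (pinnedChain ω₂ lam β γ).transitionKernel (N + 1) a b 1 z S) →
    (∀ ω₂ lam β γ : ℝ, 0 < ω₂ → 0 < lam → 0 < β → 0 < γ → ∀ (N : ℕ) (Thi : ℝ), 0 < Thi →
      ∀ ε₁ : ℝ, 0 < ε₁ → ∃ η : ℝ, 0 < η ∧ ∀ a b : ℝ, 0 < a → a ≤ Thi → 0 < b → b ≤ Thi →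
        ∀ s : ℝ≥0, (s : ℝ) ≤ η → ∀ w : PhaseSpace (N + 1), ‖w‖ < ε₁ / 2 →
          2⁻¹ ≤ (pinnedChain ω₂ lam β γ).transitionKernel (N + 1) a b s w (Metric.ball 0 ε₁)) →
    (∀ ω₂ lam β γ : ℝ, 0 < ω₂ → 0 < lam → 0 < β → 0 < γ → ∀ (N : ℕ) (s : ℝ≥0)
      (g : PhaseSpace (N + 1) → ℝ), Continuous g → (∃ B : ℝ, ∀ y, |g y| ≤ B) →
      ContinuousOn (fun p : ℝ × ℝ × PhaseSpace (N + 1) =>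
          ∫ y, g y ∂((pinnedChain ω₂ lam β γ).transitionKernel (N + 1) p.1 p.2.1 s p.2.2))
        (Set.Ioi (0 : ℝ) ×ˢ (Set.Ioi (0 : ℝ) ×ˢ (Set.univ : Set (PhaseSpace (N + 1)))))) →
    ∀ ω₂ lam β γ : ℝ, 0 < ω₂ → 0 < lam → 0 < β → 0 < γ → ∀ (N : ℕ) (T : ℝ), 0 < T →
      ∃ δ₀ : ℝ, 0 < δ₀ ∧ δ₀ < 2 * T ∧
        ∀ C : Set (PhaseSpace (N + 1)), IsCompact C → ∃ t_C : ℝ≥0, ∀ t : ℝ≥0, t_C ≤ t →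
          ∃ α : ℝ≥0∞, 0 < α ∧ ∀ δ : ℝ, |δ| ≤ δ₀ →
            ∃ ν : Measure (PhaseSpace (N + 1)), IsProbabilityMeasure ν ∧
              ∀ z ∈ C, α • ν ≤
                (pinnedChain ω₂ lam β γ).transitionKernel (N + 1) (T + δ / 2) (T - δ / 2) t z := by
  intro h1 h2 h3 ω₂ lam β γ hω hl hβ hγ N T hT
  classical
  set P := pinnedChain ω₂ lam β γ with hP
  have hN : 0 < N + 1 := Nat.succ_pos N
  refine ⟨T, hT, by linarith, ?_⟩
  intro C hC
  -- temperatures for `|δ| ≤ T` lie in `[T/2, 3T/2]`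
  have htemp : ∀ δ : ℝ, |δ| ≤ T →
      T / 2 ≤ T + δ / 2 ∧ T + δ / 2 ≤ 3 * T / 2 ∧ T / 2 ≤ T - δ / 2 ∧ T - δ / 2 ≤ 3 * T / 2 := by
    intro δ hδ
    obtain ⟨hδ1, hδ2⟩ := abs_le.mp hδ
    refine ⟨?_, ?_, ?_, ?_⟩ <;> linarith
  -- the kernel family
  set κ : ℝ → ℝ≥0 → Kernel (PhaseSpace (N + 1)) (PhaseSpace (N + 1)) := fun δ t =>
    P.transitionKernel (N + 1) (T + δ / 2) (T - δ / 2) t with hκ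
  haveI hmk : ∀ δ t, IsMarkovKernel (κ δ t) := fun δ t =>
    pinnedChain_isMarkovKernel_transitionKernel hω hl.le hβ.le hγ.le (N + 1) _ _ t
  have h_add : ∀ (δ : ℝ) (s t : ℝ≥0), κ δ (s + t) = κ δ t ∘ₖ κ δ s := fun δ s t =>
    pinnedChain_transitionKernel_add hω hl.le hβ.le hγ.le (N + 1) _ _ s t
  -- (1) local minorisation at time one, uniform on `[T/2, 3T/2]²`
  obtain ⟨ε₁, hε₁, r, hr, c, hc, hmin⟩ :=
    h1 ω₂ lam β γ hω hl hβ hγ N (T / 2) (3 * T / 2) (by positivity) (by linarith)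
  -- (2) short-time confinement, uniform for temperatures `≤ 3T/2`
  obtain ⟨η, hη, hhalf⟩ := h2 ω₂ lam β γ hω hl hβ hγ N (3 * T / 2) (by positivity) ε₁ hε₁
  -- the minorising measure `ν₀` and the small open set `G₀ ∋ 0`
  set ν₀ : Measure (PhaseSpace (N + 1)) :=
    (2⁻¹ * c) • (volume : Measure (PhaseSpace (N + 1))).restrict (Metric.ball 0 r) with hν₀
  set G₀ : Set (PhaseSpace (N + 1)) := Metric.ball 0 (ε₁ / 2) with hG₀
  have hG₀o : IsOpen G₀ := Metric.isOpen_ball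
  have hG₀m : MeasurableSet G₀ := hG₀o.measurableSet
  have h0G₀ : (0 : PhaseSpace (N + 1)) ∈ G₀ := Metric.mem_ball_self (by positivity)
  set η' : ℝ := min η 1 with hη'
  have hη'0 : 0 < η' := lt_min hη one_pos
  have hη'η : η' ≤ η := min_le_left _ _
  -- the local small set, uniformly in `δ`: `ν₀ ≤ K^δ_t(w, ·)` for `t ∈ [1, 1+η']`, `w ∈ G₀`
  have hloc : ∀ δ : ℝ, |δ| ≤ T → ∀ t : ℝ≥0, (1 : ℝ) ≤ t → (t : ℝ) ≤ 1 + η' →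
      ∀ w ∈ G₀, ν₀ ≤ κ δ t w := by
    intro δ hδ t ht1 ht2 w hw
    obtain ⟨ha1, ha2, hb1, hb2⟩ := htemp δ hδ
    have ha0 : 0 < T + δ / 2 := by linarith
    have hb0 : 0 < T - δ / 2 := by linarith
    set ν : Measure (PhaseSpace (N + 1)) :=
      c • (volume : Measure (PhaseSpace (N + 1))).restrict (Metric.ball 0 r) with hν
    have hν1 : ∀ w' ∈ Metric.ball (0 : PhaseSpace (N + 1)) ε₁, ν ≤ κ δ 1 w' := by
      intro w' hw'
      refine Measure.le_iff.2 fun A hA => ?_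
      rw [hν, Measure.smul_apply, Measure.restrict_apply hA, smul_eq_mul]
      have hw'n : ‖w'‖ < ε₁ := by simpa using hw'
      exact (hmin _ _ ha1 ha2 hb1 hb2 w' hw'n (A ∩ Metric.ball 0 r) Set.inter_subset_right
        (hA.inter Metric.isOpen_ball.measurableSet)).trans (measure_mono Set.inter_subset_left)
    set s : ℝ≥0 := t - 1 with hs
    have hts : t = s + 1 := by rw [hs, tsub_add_cancel_of_le (by exact_mod_cast ht1)]
    have hsη : (s : ℝ) ≤ η := by
      have : ((t - 1 : ℝ≥0) : ℝ) = t - 1 := NNReal.coe_sub (by exact_mod_cast ht1)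
      rw [hs, this]; linarith
    have hwn : ‖w‖ < ε₁ / 2 := by simpa [hG₀] using hw
    have hck := MarkovSemigroup.smul_le_comp (κ δ) (h_add δ) s 1 w (Metric.ball 0 ε₁) hν1
    have hhalf' : 2⁻¹ ≤ κ δ s w (Metric.ball 0 ε₁) := hhalf _ _ ha0 ha2 hb0 hb2 s hsη w hwn
    rw [hts]
    calc ν₀ = (2⁻¹ : ℝ≥0∞) • ν := by rw [hν₀, hν, smul_smul]
      _ ≤ (κ δ s w (Metric.ball 0 ε₁)) • ν := IsOrderedSMul.smul_le_smul_right _ _ hhalf' ν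
      _ ≤ κ δ (s + 1) w := hck
  -- `ν₀` charges `G₀`, and is finite
  have hν₀G₀ : 0 < ν₀ G₀ := by
    rw [hν₀, Measure.smul_apply, Measure.restrict_apply hG₀m, smul_eq_mul]
    refine ENNReal.mul_pos (ENNReal.mul_pos (by simp) hc.ne').ne' ?_
    exact ((hG₀o.inter Metric.isOpen_ball).measure_pos volume
      ⟨0, h0G₀, Metric.mem_ball_self hr⟩).ne'
  have hν₀fin : ν₀ Set.univ < ∞ := by
    have h := Measure.le_iff'.1 (hloc 0 (by simp [hT.le]) 1 (by simp)
      (by push_cast; linarith) 0 h0G₀) Set.univ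
    exact lt_of_le_of_lt h (measure_lt_top _ _)
  have hν₀ne : ν₀ Set.univ ≠ 0 := fun h0 =>
    hν₀G₀.ne' (measure_mono_null (Set.subset_univ _) h0)
  -- return bound on the window `[1, 1+η']` with constant `c₂ = ν₀(G₀)`, uniformly in `δ`
  set c₂ : ℝ≥0∞ := ν₀ G₀ with hc₂
  have hcycle : ∀ δ : ℝ, |δ| ≤ T → ∀ u : ℝ≥0, (1 : ℝ) ≤ (u : ℝ) → (u : ℝ) ≤ 1 + η' →
      ∀ w ∈ G₀, c₂ ≤ κ δ u w G₀ :=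
    fun δ hδ u hu1 hu2 w hw => Measure.le_iff'.1 (hloc δ hδ u hu1 hu2 w hw) G₀
  have hc₂1 : c₂ ≤ 1 :=
    (hcycle 0 (by simp [hT.le]) 1 (by simp) (by push_cast; linarith) 0 h0G₀).trans prob_le_one
  -- iteration over windows and all large times
  have hiter : ∀ δ : ℝ, |δ| ≤ T → ∀ k : ℕ, 1 ≤ k → ∀ u : ℝ≥0, k * (1 : ℝ) ≤ (u : ℝ) →
      (u : ℝ) ≤ k * (1 + η') → ∀ w ∈ G₀, c₂ ^ k ≤ κ δ u w G₀ :=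
    fun δ hδ => MarkovSemigroup.pow_le_apply_of_window (κ δ) (h_add δ) hG₀m zero_le_one
      (by linarith) (hcycle δ hδ)
  set Tf : ℝ := max (1 + η') (1 * (1 + η') / ((1 + η') - 1)) with hTf
  have hlarge : ∀ u : ℝ≥0, Tf ≤ (u : ℝ) → ∃ cu : ℝ≥0∞, 0 < cu ∧ cu ≤ 1 ∧
      ∀ δ : ℝ, |δ| ≤ T → ∀ w ∈ G₀, cu ≤ κ δ u w G₀ := by
    intro u hu
    obtain ⟨k, hk1, hk2, hk3⟩ :=
      MarkovSemigroup.exists_nat_mul_le_le_mul zero_le_one (by linarith : (1 : ℝ) < 1 + η') hu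
    exact ⟨c₂ ^ k, ENNReal.pow_pos hν₀G₀ k, pow_le_one' hc₂1 k,
      fun δ hδ w hw => hiter δ hδ k hk1 u hk2 hk3 w hw⟩
  -- landing once more with the local small set: `K^δ_{u+1}(w, ·) ≥ cu • ν₀` on `G₀`
  have hland : ∀ u : ℝ≥0, Tf ≤ (u : ℝ) → ∃ cu : ℝ≥0∞, 0 < cu ∧ cu ≤ 1 ∧
      ∀ δ : ℝ, |δ| ≤ T → ∀ w ∈ G₀, cu • ν₀ ≤ κ δ (u + 1) w := by
    intro u hu
    obtain ⟨cu, hcu0, hcu1, hcu⟩ := hlarge u hu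
    refine ⟨cu, hcu0, hcu1, fun δ hδ w hw => ?_⟩
    have h1 : (κ δ u w G₀) • ν₀ ≤ κ δ (u + 1) w :=
      MarkovSemigroup.smul_le_comp (κ δ) (h_add δ) u 1 w G₀ fun w' hw' =>
        hloc δ hδ 1 (by simp) (by push_cast; linarith) w' hw'
    exact (IsOrderedSMul.smul_le_smul_right _ _ (hcu δ hδ w hw) ν₀).trans h1
  -- (3) ⟹ lower semicontinuity of `(δ, z) ↦ K^δ_s(z, G₀)` at admissible points
  have hlsc : ∀ (s : ℝ≥0) (q : ℝ × PhaseSpace (N + 1)), |q.1| ≤ T → 0 < κ q.1 s q.2 G₀ →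
      ∃ (a : ℝ≥0∞) (O : Set (ℝ × PhaseSpace (N + 1))), IsOpen O ∧ q ∈ O ∧ 0 < a ∧ a ≤ 1 ∧
        ∀ q' ∈ O, a ≤ κ q'.1 s q'.2 G₀ := by
    intro s q hq hpos
    let Tm : ℝ × PhaseSpace (N + 1) → ProbabilityMeasure (PhaseSpace (N + 1)) := fun q' =>
      ⟨κ q'.1 s q'.2, inferInstance⟩
    have hopen : IsOpen (Set.Ioi (0 : ℝ) ×ˢ (Set.Ioi (0 : ℝ) ×ˢ (Set.univ : Set (PhaseSpace (N + 1))))) :=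
      isOpen_Ioi.prod (isOpen_Ioi.prod isOpen_univ)
    have hmem : ((T + q.1 / 2, T - q.1 / 2, q.2) : ℝ × ℝ × PhaseSpace (N + 1)) ∈
        Set.Ioi (0 : ℝ) ×ˢ (Set.Ioi (0 : ℝ) ×ˢ (Set.univ : Set (PhaseSpace (N + 1)))) := by
      obtain ⟨hq1, hq2⟩ := abs_le.mp hq
      exact ⟨show 0 < T + q.1 / 2 by linarith, show 0 < T - q.1 / 2 by linarith, Set.mem_univ _⟩
    have hφ : Continuous fun q' : ℝ × PhaseSpace (N + 1) =>
        ((T + q'.1 / 2, T - q'.1 / 2, q'.2) : ℝ × ℝ × PhaseSpace (N + 1)) := by fun_prop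
    have hTmcoe : ∀ q' : ℝ × PhaseSpace (N + 1), (Tm q' : Measure (PhaseSpace (N + 1))) =
        P.transitionKernel (N + 1) (T + q'.1 / 2) (T - q'.1 / 2) s q'.2 := fun q' => rfl
    have hTm : Tendsto Tm (𝓝 q) (𝓝 (Tm q)) := by
      rw [ProbabilityMeasure.tendsto_iff_forall_integral_tendsto]
      intro g
      have hgb : ∃ B : ℝ, ∀ y, |g y| ≤ B :=
        ⟨‖g‖, fun y => by rw [← Real.norm_eq_abs]; exact g.norm_coe_le_norm y⟩
      have hcont := h3 ω₂ lam β γ hω hl hβ hγ N s g g.continuous hgb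
      have hca : ContinuousAt (fun p : ℝ × ℝ × PhaseSpace (N + 1) =>
          ∫ y, g y ∂(P.transitionKernel (N + 1) p.1 p.2.1 s p.2.2)) (T + q.1 / 2, T - q.1 / 2, q.2) :=
        hcont.continuousAt (hopen.mem_nhds hmem)
      have key : ContinuousAt (fun q' : ℝ × PhaseSpace (N + 1) =>
          ∫ y, g y ∂(P.transitionKernel (N + 1) (T + q'.1 / 2) (T - q'.1 / 2) s q'.2)) q :=
        ContinuousAt.comp (f := fun q' : ℝ × PhaseSpace (N + 1) =>
          ((T + q'.1 / 2, T - q'.1 / 2, q'.2) : ℝ × ℝ × PhaseSpace (N + 1))) hca hφ.continuousAt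
      simp only [hTmcoe]
      exact key.tendsto
    have hlim := ProbabilityMeasure.le_liminf_measure_open_of_tendsto hTm hG₀o
    have hne : κ q.1 s q.2 G₀ ≠ 0 := hpos.ne'
    have hhf : κ q.1 s q.2 G₀ / 2 < κ q.1 s q.2 G₀ := ENNReal.half_lt_self hne (measure_ne_top _ _)
    have hev : ∀ᶠ q' in 𝓝 q, κ q.1 s q.2 G₀ / 2 < κ q'.1 s q'.2 G₀ :=
      eventually_lt_of_lt_liminf (lt_of_lt_of_le hhf hlim)
    obtain ⟨O, hOsub, hOo, hqO⟩ := mem_nhds_iff.1 hev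
    exact ⟨_, O, hOo, hqO, ENNReal.half_pos hne, ENNReal.half_le_self.trans prob_le_one,
      fun q' hq' => (hOsub hq').le⟩
  -- every admissible (δ, z) reaches `G₀` with uniformly positive probability on a neighbourhood
  have hreach : ∀ q : ℝ × PhaseSpace (N + 1), ∃ (s : ℝ≥0) (a : ℝ≥0∞) (O : Set (ℝ × PhaseSpace (N + 1))),
      |q.1| ≤ T → (IsOpen O ∧ q ∈ O ∧ 0 < a ∧ a ≤ 1 ∧ ∀ q' ∈ O, a ≤ κ q'.1 s q'.2 G₀) := by
    intro q
    by_cases hq : |q.1| ≤ T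
    · obtain ⟨s, hs⟩ := pinnedChain_exists_transitionKernel_pos_of_zero_mem hω hl.le hβ.le hγ hN
        (T + q.1 / 2) (T - q.1 / 2) q.2 G₀ hG₀o h0G₀
      obtain ⟨a, O, hO, hqO, ha0, ha1, hb⟩ := hlsc s q hq hs
      exact ⟨s, a, O, fun _ => ⟨hO, hqO, ha0, ha1, hb⟩⟩
    · exact ⟨0, 1, Set.univ, fun h => absurd h hq⟩
  choose s a O hO using hreach
  -- the compact set of (parameter, initial condition) and a finite subcover
  set K : Set (ℝ × PhaseSpace (N + 1)) := Set.Icc (-T) T ×ˢ C with hK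
  have hKc : IsCompact K := isCompact_Icc.prod hC
  have hKadm : ∀ q ∈ K, |q.1| ≤ T := fun q hq => abs_le.mpr hq.1
  obtain ⟨F, hFK, hcover⟩ := hKc.elim_nhds_subcover O fun q hq =>
    (hO q (hKadm q hq)).1.mem_nhds (hO q (hKadm q hq)).2.1
  -- the time `t_C`
  set S : ℝ≥0 := F.sup s with hS
  have hsS : ∀ q ∈ F, s q ≤ S := fun q hq => Finset.le_sup hq
  set M : ℝ≥0 := ⟨max Tf 0, le_max_right _ _⟩ with hM
  have hMcoe : (M : ℝ) = max Tf 0 := rfl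
  refine ⟨M + 1 + S, fun t ht => ?_⟩
  have hdecomp : ∀ q ∈ F, ∃ u : ℝ≥0, Tf ≤ (u : ℝ) ∧ t = s q + (u + 1) := by
    intro q hq
    have hq1 : s q + 1 + M ≤ t := by
      calc s q + 1 + M ≤ S + 1 + M := by gcongr; exact hsS q hq
        _ = M + 1 + S := by ring
        _ ≤ t := ht
    have hq2 : s q + 1 ≤ t := le_trans le_self_add hq1
    refine ⟨t - (s q + 1), ?_, ?_⟩
    · have hcoe : (((t - (s q + 1) : ℝ≥0)) : ℝ) = t - (s q + 1) := NNReal.coe_sub hq2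
      have hq1' : ((s q + 1 + M : ℝ≥0) : ℝ) ≤ t := by exact_mod_cast hq1
      rw [NNReal.coe_add, NNReal.coe_add, hMcoe] at hq1'
      rw [hcoe]
      have : Tf ≤ max Tf 0 := le_max_left _ _
      linarith
    · rw [add_comm (t - (s q + 1)) 1, ← add_assoc, add_tsub_cancel_of_le hq2]
  choose! u hu ht_eq using hdecomp
  have hcl : ∀ q ∈ F, ∃ cu : ℝ≥0∞, 0 < cu ∧ cu ≤ 1 ∧
      ∀ δ : ℝ, |δ| ≤ T → ∀ w ∈ G₀, cu • ν₀ ≤ κ δ (u q + 1) w := fun q hq => hland (u q) (hu q hq)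
  choose! cu hcu0 hcu1 hculand using hcl
  -- the uniform constant
  set ε : ℝ≥0∞ := ∏ q ∈ F, a q * cu q with hε
  have hεpos : 0 < ε := by
    rw [hε, pos_iff_ne_zero, Finset.prod_ne_zero_iff]
    exact fun q hq => mul_ne_zero (hO q (hKadm q (hFK q hq))).2.2.1.ne' (hcu0 q hq).ne'
  have hfac1 : ∀ q ∈ F, a q * cu q ≤ 1 := fun q hq =>
    mul_le_one' (hO q (hKadm q (hFK q hq))).2.2.2.1 (hcu1 q hq)
  have hεle : ∀ q ∈ F, ε ≤ a q * cu q := by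
    intro q hq
    rw [hε, ← Finset.mul_prod_erase F (fun q => a q * cu q) hq]
    exact mul_le_of_le_one_right' (Finset.prod_le_one' fun w hw => hfac1 w (Finset.mem_of_mem_erase hw))
  -- the bound `ε • ν₀ ≤ K^δ_t(z, ·)` for `z ∈ C`, `|δ| ≤ T`
  have hmain : ∀ δ : ℝ, |δ| ≤ T → ∀ z ∈ C, ε • ν₀ ≤ κ δ t z := by
    intro δ hδ z hz
    have hqK : ((δ, z) : ℝ × PhaseSpace (N + 1)) ∈ K := ⟨abs_le.mp hδ, hz⟩
    obtain ⟨qi, hqiF, hqO⟩ : ∃ qi ∈ F, ((δ, z) : ℝ × PhaseSpace (N + 1)) ∈ O qi := by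
      have := hcover hqK
      simp only [Set.mem_iUnion, exists_prop] at this
      exact this
    have hbound : a qi ≤ κ δ (s qi) z G₀ := (hO qi (hKadm qi (hFK qi hqiF))).2.2.2.2 (δ, z) hqO
    have hck : (κ δ (s qi) z G₀) • (cu qi • ν₀) ≤ κ δ (s qi + (u qi + 1)) z :=
      MarkovSemigroup.smul_le_comp (κ δ) (h_add δ) (s qi) (u qi + 1) z G₀ fun w hw =>
        hculand qi hqiF δ hδ w hw
    rw [← ht_eq qi hqiF] at hck
    calc ε • ν₀ ≤ (a qi * cu qi) • ν₀ := IsOrderedSMul.smul_le_smul_right _ _ (hεle qi hqiF) ν₀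
      _ ≤ (κ δ (s qi) z G₀ * cu qi) • ν₀ :=
          IsOrderedSMul.smul_le_smul_right _ _ (mul_le_mul' hbound le_rfl) ν₀
      _ = (κ δ (s qi) z G₀) • (cu qi • ν₀) := (smul_smul _ _ _).symm
      _ ≤ κ δ t z := hck
  -- normalise `ν₀` to a probability measure
  refine ⟨ε * ν₀ Set.univ, ENNReal.mul_pos hεpos.ne' hν₀ne, fun δ hδ => ?_⟩
  refine ⟨(ν₀ Set.univ)⁻¹ • ν₀, ?_, fun z hz => ?_⟩
  · constructor
    rw [Measure.smul_apply, smul_eq_mul, ENNReal.inv_mul_cancel hν₀ne hν₀fin.ne]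
  · have hsm : (ε * ν₀ Set.univ) • ((ν₀ Set.univ)⁻¹ • ν₀) = ε • ν₀ := by
      rw [smul_smul, mul_assoc, ENNReal.mul_inv_cancel hν₀ne hν₀fin.ne, mul_one]
    rw [hsm]
    exact hmain δ hδ z hz

end Summit.AtomisticToContinuum.FouriersLaw.Theorems.BoundaryKubo.GibbsTtcf

end
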